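import Summits.AtomisticToContinuum.HydrodynamicLimit.Theorems.AnnealedZeroHorizonMeanFluxClosureCollisionEnergyExchangeMeanBoundB
import HarnessLib

/-!
# Stub FLUX-RS `stub_relSpeedCollisionMeanBound` of crux `MeanFluxClosure`
# (stmt-AtomisticToContinuum-9256, route AnnealedZeroHorizon, line `registered`, skeleton r7) — part B:
# the general case REDUCED to the crux item `BGEndpointRigidity.LanfordEnvelopeR`

The stub FLUX-RS asks, with `RS(z) = Σ_{t_c ∈ (t₁,t₂]} Σ_{(i,j) colliding} ‖vᵢ⁻ − vⱼ⁻‖` the windowed RELATIVE-SPEED collision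
functional of the hard-sphere flow (Literature `HardSphereFlow.collisionalTransferFunctional` of the time-`t₁` point over
`(0, t₂ − t₁]`, kernel `(i, j, z⁻, z⁺) ↦ ‖vᵢ⁻ − vⱼ⁻‖`), that `Q = σ_N (N+1)⁻¹ RS` be integrable with `E Q ≤ C` eventually in
`N` under the TRUE (non-stationary) local Gibbs law `localGibbsLaw σ a₀ u₀ θ₀ N (Φ N)`. Integrability holds at every `N`
(`CollisionEnergyExchangeMeanBound.integrable_relSpeedFunctional_flow`); the MEAN bound out of equilibrium is the open
two-particle contact statistic of stub FLUX. This file is the relative-speed twin of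
`…CollisionEnergyExchangeMeanBoundB` (energy mark):

* `integral_relSpeedFunctional_flow_le_of_relSpeedFluxBound` — at each `N` the mean half follows from a bound on the mean
  RELATIVE-SPEED-weighted contact flux of the non-stationary local Gibbs law over the collision times in `[t₁, t₂]`,
  `(ε_N/(N+1)) E_{LG_N}[Σᶠ_{r ∈ [t₁,t₂]} Σᵢ Σ_k 𝟙{contact} ‖vᵢ − v_k‖(Φ_r z)] ≤ C` (generic engine
  `integral_flow_le_of_windowFluxBound`; the pre-collisional relative speed IS the post-collisional one,
  `relSpeedKernel_eq_mark`);
* `stub_of_marginalEnvelope` — that flux bound, uniformly in `N ≥ N₀`, from the PAIR ENVELOPE (A) of crux `CollisionRate` at the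
  times of the window (`lintegral_windowCollisionSum_le_of_pairEnvelope`, the non-stationary one-window / Campbell inequality of
  Cercignani–Illner–Pulvirenti, with the mark `b(v, w) = ‖v − w‖`), the Gaussian flux integral
  `∫ ‖w − v‖ ‖v − w‖ dN(u,θ)^{⊗2} ≤ 4 (3θ + ‖u‖²)` (`mmr_lintegral_norm_sub_sq_prod_gaussMeasure_le`) and `(N+1) ε_N³ = σ³`:
  `E Q ≤ 16 C (t₂ − t₁) σ³ (3θ + ‖u‖²)`;
* `stub_relSpeedCollisionMeanBound_of_lanfordEnvelopeR` — hence the registered stub, VERBATIM, follows from the crux item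
  `Theses.BGEndpointRigidity.LanfordEnvelopeR` (stmt-13677; `CollisionRate.stub_marginalEnvelopeLG_of_lanfordEnvelopeR`), the
  Lanford/BGSR Gaussian envelope of the marginals of the evolved local Gibbs law, open at positive times at fixed reduced density.

References: C. Cercignani, R. Illner, M. Pulvirenti, *The Mathematical Theory of Dilute Gases* (1994) App. 4.A;
I. Gallagher, L. Saint-Raymond, B. Texier, *From Newton to Boltzmann* (2013) Ch. 4–6; H. Spohn, *Large Scale Dynamics of
Interacting Particles* (1991) Part I §2.3.
-/

noncomputable section

namespace Summit.AtomisticToContinuum.HydrodynamicLimit.Theorems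

open scoped BigOperators ENNReal Topology
open MeasureTheory Set Filter
open Literature.MathematicalPhysics.KineticTheory Literature.Analysis.FluidPDE Literature.Analysis.FunctionSpaces
open Summit.AtomisticToContinuum.HydrodynamicLimit.Theorems.RestartPrinciple.AgeDuhamelForgetting
open Summit.AtomisticToContinuum.HydrodynamicLimit.Theorems.CollisionEnergyExchangeMeanBound

namespace RelSpeedCollisionMeanBound

variable {a₀ θ₀ : T3 → ℝ} {u₀ : T3 → V3}

/-! ## The mean half REDUCED to the mean relative-speed-weighted contact flux of the non-stationary law -/

/-- **The relative-speed case of the window-flux reduction, at every `N`**: for continuous `a₀, θ₀ > 0`, `u₀`,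
`0 < σ ≤ 1/2`, a flow `Φ`, `0 ≤ t₁ ≤ t₂` and `C ≥ 0`, IF
`(ε_N/(N+1)) E_{LG}[Σᶠ_{r ∈ [t₁,t₂]} Σᵢ Σ_k 𝟙{contact} ‖vᵢ − v_k‖(Φ_r z)] ≤ C` under `LG = localGibbsLaw σ a₀ u₀ θ₀ N Φ`, THEN
`(ε_N/(N+1)) E_{LG}[RS(Φ_{t₁} z; (0, t₂ − t₁])] ≤ C` (`integral_flow_le_of_windowFluxBound` with the mark `‖vᵢ − v_k‖`, a collision
invariant: `relSpeedKernel_eq_mark`; integrability is unconditional, `integrable_relSpeedFunctional_flow`; `N = 0` is trivial).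
[folklore] -/
theorem integral_relSpeedFunctional_flow_le_of_relSpeedFluxBound (ha : Continuous a₀) (hθ : Continuous θ₀)
    (hu : Continuous u₀) (ha0 : ∀ x, 0 < a₀ x) (hθ0 : ∀ x, 0 < θ₀ x) {σ : ℝ} (hσ : 0 < σ) (hσ2 : σ ≤ 1 / 2) {N : ℕ}
    (Φ : HardSphereFlow (Torus.geometry (Fin 3)) (hsDiameter σ N) (N + 1)) {t₁ t₂ : ℝ} (h₁ : 0 ≤ t₁) (h₁₂ : t₁ ≤ t₂)
    {C : ℝ} (hC : 0 ≤ C)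
    (hflux : ENNReal.ofReal (hsDiameter σ N / ((N + 1 : ℕ) : ℝ)) *
      ∫⁻ z, (∑ᶠ r ∈ collisionTimes (Torus.geometry (Fin 3)) (hsDiameter σ N) (fun t => Φ.flow t z) ∩ Icc t₁ t₂,
        ∑ i, ∑ k, (if i ≠ k ∧ ‖(Torus.geometry (Fin 3)).sepVec (Φ.flow r z i).1 (Φ.flow r z k).1‖ = hsDiameter σ N
          then ENNReal.ofReal ‖(Φ.flow r z i).2 - (Φ.flow r z k).2‖ else 0))
        ∂(localGibbsLaw σ a₀ u₀ θ₀ N Φ) ≤ ENNReal.ofReal C) :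
    hsDiameter σ N * ((N + 1 : ℕ) : ℝ)⁻¹ * ∫ z, Φ.collisionalTransferFunctional
        (fun (i j : Fin (N + 1)) (pre _post : Config (N + 1) (Fin 3) T3) => ‖(pre i).2 - (pre j).2‖)
        (Φ.flow t₁ z) (t₂ - t₁) ∂(localGibbsLaw σ a₀ u₀ θ₀ N Φ) ≤ C := by
  -- adapted from `CollisionEnergyExchangeMeanBound.integral_absEnergyJumpFunctional_flow_le_of_energyFluxBound`
  rcases Nat.eq_zero_or_pos N with hN0 | hN
  · subst hN0
    have h0 : ∀ z, Φ.collisionalTransferFunctional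
        (fun (i j : Fin (0 + 1)) (pre _post : Config (0 + 1) (Fin 3) T3) => ‖(pre i).2 - (pre j).2‖)
        (Φ.flow t₁ z) (t₂ - t₁) = 0 := fun z => collisionalTransferFunctional_eq_zero_of_le_one Φ le_rfl _ _ _
    simp only [h0, integral_zero, mul_zero]
    exact hC
  · have hPac : localGibbsLaw σ a₀ u₀ θ₀ N Φ ≪ liouville (Torus.geometry (Fin 3)) (N + 1) (hsDiameter σ N) := by
      rw [localGibbsLaw_eq]; exact localGibbsMeasure_absolutelyContinuous σ _ _ _ N Φ
    exact integral_flow_le_of_windowFluxBound hσ hN hσ2 Φ (fun _ _ _ _ => norm_nonneg _)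
      (M := fun w i k => ‖(w i).2 - (w k).2‖) (fun _ _ _ => norm_nonneg _)
      (fun hγ t p hp => (relSpeedKernel_eq_mark hγ t p hp).le) _ (hPac Φ.measure_compl_good)
      (integrable_relSpeedFunctional_flow ha hθ hu ha0 hθ0 hσ hσ2 Φ h₁ h₁₂) hC hflux

/-! ## The stub from the pair envelope of the evolved law; the stub from `LanfordEnvelopeR` -/

/-- **The registered stub FLUX-RS FOLLOWS from the marginal envelope (A) of the evolved local Gibbs law** — hypothesis (A) of
crux `InformationPercolationEngine.CollisionRate` VERBATIM (pair and triple conjuncts; only the pair one is used): with the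
Gaussian flux integral of the relative-speed mark `∫ ‖w − v‖ ‖v − w‖ dN(u,θ)^{⊗2} ≤ 4 (3θ + ‖u‖²)`
(`mmr_lintegral_norm_sub_sq_prod_gaussMeasure_le`) and `(N+1) ε_N³ = σ³`, `lintegral_windowCollisionSum_le_of_pairEnvelope`
(mark `b(v, w) = ‖v − w‖`) gives the window flux bound `(ε_N/(N+1)) E[…] ≤ 4 C (t₂ − t₁) σ³ · 4 (3θ + ‖u‖²)` for `N ≥ N₀`, and
`integral_relSpeedFunctional_flow_le_of_relSpeedFluxBound` the stub (`σ₀ := min σ₀(A) (1/2)`; the window `t₁ = t₂` is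
trivial). [folklore] -/
theorem stub_of_marginalEnvelope
    (hA : ∀ (a₀ θ₀ : T3 → ℝ) (u₀ : T3 → V3), Continuous a₀ → Continuous θ₀ → Continuous u₀ →
      (∀ x, 0 < a₀ x) → (∀ x, 0 < θ₀ x) → ∃ σ₀ : ℝ, 0 < σ₀ ∧ ∀ σ : ℝ, 0 < σ → σ < σ₀ →
      ∀ Φ : (N : ℕ) → HardSphereFlow (Torus.geometry (Fin 3)) (hsDiameter σ N) (N + 1),
      ∀ τ : ℝ, 0 < τ → ∃ C : ℝ, 0 ≤ C ∧ ∃ u : V3, ∃ θ : ℝ, 0 < θ ∧ ∃ N₀ : ℕ, ∀ N : ℕ, N₀ ≤ N →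
      ∀ t ∈ Set.Icc (0 : ℝ) τ,
        (∀ i j : Fin (N + 1), i ≠ j → ∀ f : (T3 × V3) × (T3 × V3) → ℝ≥0∞, Measurable f →
          ∫⁻ z, f ((Φ N).flow t z i, (Φ N).flow t z j) ∂(localGibbsLaw σ a₀ u₀ θ₀ N (Φ N)) ≤
            ENNReal.ofReal C * ∫⁻ q, f q ∂(((volume : Measure T3).prod (gaussMeasure u θ)).prod
              ((volume : Measure T3).prod (gaussMeasure u θ)))) ∧
        (∀ i j k : Fin (N + 1), i ≠ j → i ≠ k → j ≠ k → ∀ f : (T3 × V3) × (T3 × V3) × (T3 × V3) → ℝ≥0∞, Measurable f →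
          ∫⁻ z, f ((Φ N).flow t z i, (Φ N).flow t z j, (Φ N).flow t z k) ∂(localGibbsLaw σ a₀ u₀ θ₀ N (Φ N)) ≤
            ENNReal.ofReal C * ∫⁻ q, f q ∂(((volume : Measure T3).prod (gaussMeasure u θ)).prod
              (((volume : Measure T3).prod (gaussMeasure u θ)).prod ((volume : Measure T3).prod (gaussMeasure u θ)))))) :
    ∀ (a₀ θ₀ : Literature.MathematicalPhysics.KineticTheory.T3 → ℝ) (u₀ : Literature.MathematicalPhysics.KineticTheory.T3 → Literature.MathematicalPhysics.KineticTheory.V3), Continuous a₀ → Continuous θ₀ → Continuous u₀ → (∀ x, 0 < a₀ x) → (∀ x, 0 < θ₀ x) → ∃ σ₀ : ℝ, 0 < σ₀ ∧ ∀ σ : ℝ, 0 < σ → σ < σ₀ → ∀ Φ : (N : ℕ) → Literature.Analysis.FluidPDE.HardSphereFlow (Literature.Analysis.FluidPDE.Torus.geometry (Fin 3)) (Literature.MathematicalPhysics.KineticTheory.hsDiameter σ N) (N + 1), ∀ t₁ t₂ : ℝ, 0 ≤ t₁ → t₁ ≤ t₂ → ∃ C : ℝ, ∀ᶠ N in Filter.atTop,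 ∀ Q : Literature.Analysis.FluidPDE.Config (N + 1) (Fin 3) Literature.MathematicalPhysics.KineticTheory.T3 → ℝ, Q = (fun z => Literature.MathematicalPhysics.KineticTheory.hsDiameter σ N * ((N + 1 : ℕ) : ℝ)⁻¹ * (Φ N).collisionalTransferFunctional (fun (i j : Fin (N + 1)) (pre _post : Literature.Analysis.FluidPDE.Config (N + 1) (Fin 3) Literature.MathematicalPhysics.KineticTheory.T3) => ‖(pre i).2 - (pre j).2‖) ((Φ N).flow t₁ z) (t₂ - t₁)) → MeasureTheory.Integrable Q (Literature.MathematicalPhysics.KineticTheory.localGibbsLaw σ a₀ u₀ θ₀ N (Φ N)) ∧ ∫ z, Q z ∂Literature.MathematicalPhysics.KineticTheory.localGibbsLaw σ a₀ u₀ θ₀ N (Φ N) ≤ C := by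
  -- adapted from `CollisionEnergyExchangeMeanBound.stub_of_marginalEnvelope` (energy mark ↦ relative-speed mark)
  intro a₀ θ₀ u₀ ha hθ hu ha0 hθ0
  obtain ⟨σ₀, hσ₀, hA'⟩ := hA a₀ θ₀ u₀ ha hθ hu ha0 hθ0
  refine ⟨min σ₀ (1 / 2), lt_min hσ₀ (by norm_num), fun σ hσ hσlt Φ t₁ t₂ h₁ h₁₂ => ?_⟩
  have hσ2 : σ ≤ 1 / 2 := (hσlt.trans_le (min_le_right _ _)).le
  rcases eq_or_lt_of_le h₁₂ with heq | hlt
  · subst heq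
    refine ⟨0, Eventually.of_forall fun N Q hQ => ?_⟩
    subst hQ
    simp only [sub_self, HardSphereFlow.collisionalTransferFunctional_zero, mul_zero, integral_zero]
    exact ⟨integrable_zero _ _ _, le_rfl⟩
  obtain ⟨C, hC, u, θ, hθpos, N₀, hN⟩ := hA' σ hσ (hσlt.trans_le (min_le_left _ _)) Φ t₂ (h₁.trans_lt hlt)
  set K : ℝ := 4 * C * (t₂ - t₁) * σ ^ 3 * (4 * (3 * θ + ‖u‖ ^ 2)) with hKdef
  have hK0 : 0 ≤ K := by have := sub_pos.2 hlt; positivity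
  refine ⟨K, ?_⟩
  filter_upwards [eventually_ge_atTop N₀] with N hNN Q hQ
  subst hQ
  refine ⟨(integrable_relSpeedFunctional_flow ha hθ hu ha0 hθ0 hσ hσ2 (Φ N) h₁ h₁₂).const_mul _, ?_⟩
  set P := localGibbsLaw σ a₀ u₀ θ₀ N (Φ N) with hPdef
  have hPgood : P (Φ N).goodᶜ = 0 := by
    rw [hPdef, localGibbsLaw_eq]; exact localGibbsMeasure_absolutelyContinuous σ _ _ _ N (Φ N) (Φ N).measure_compl_good
  have henv : ∀ r ∈ Icc t₁ (t₁ + (t₂ - t₁)), ∀ i j : Fin (N + 1), i ≠ j → ∀ f : (T3 × V3) × (T3 × V3) → ℝ≥0∞, Measurable f →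
      ∫⁻ z, f ((Φ N).flow r z i, (Φ N).flow r z j) ∂P ≤ ENNReal.ofReal C * ∫⁻ q, f q
        ∂(((volume : Measure T3).prod (gaussMeasure u θ)).prod ((volume : Measure T3).prod (gaussMeasure u θ))) :=
    fun r hr i j hij f hf => (hN N hNN r ⟨h₁.trans hr.1, by linarith [hr.2]⟩).1 i j hij f hf
  have hw := lintegral_windowCollisionSum_le_of_pairEnvelope hσ (Φ N) P hPgood t₁ (sub_pos.2 hlt) hC (gaussMeasure u θ) henv
    (b := fun p => ‖p.1 - p.2‖) (by fun_prop)
  rw [add_sub_cancel] at hw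
  have hflux : ENNReal.ofReal (hsDiameter σ N / ((N + 1 : ℕ) : ℝ)) *
      ∫⁻ z, (∑ᶠ r ∈ collisionTimes (Torus.geometry (Fin 3)) (hsDiameter σ N) (fun t => (Φ N).flow t z) ∩ Icc t₁ t₂,
        ∑ i, ∑ k, (if i ≠ k ∧ ‖(Torus.geometry (Fin 3)).sepVec ((Φ N).flow r z i).1 ((Φ N).flow r z k).1‖ = hsDiameter σ N
          then ENNReal.ofReal ‖((Φ N).flow r z i).2 - ((Φ N).flow r z k).2‖ else 0)) ∂P ≤ ENNReal.ofReal K := by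
    have hε0 : 0 ≤ hsDiameter σ N / ((N + 1 : ℕ) : ℝ) := div_nonneg (hsDiameter_pos hσ N).le (Nat.cast_nonneg _)
    have h4 : 0 ≤ 4 * C * (t₂ - t₁) * ((N + 1 : ℕ) : ℝ) ^ 2 * hsDiameter σ N ^ 2 := by have := sub_pos.2 hlt; positivity
    have hn : ((N + 1 : ℕ) : ℝ) ≠ 0 := by positivity
    have hreal : hsDiameter σ N / ((N + 1 : ℕ) : ℝ) * (4 * C * (t₂ - t₁) * ((N + 1 : ℕ) : ℝ) ^ 2 * hsDiameter σ N ^ 2 *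
        (4 * (3 * θ + ‖u‖ ^ 2))) = K := by
      calc _ = (((N + 1 : ℕ) : ℝ))⁻¹ * ((N + 1 : ℕ) : ℝ) * (4 * C * (t₂ - t₁) * (((N + 1 : ℕ) : ℝ) * hsDiameter σ N ^ 3) *
            (4 * (3 * θ + ‖u‖ ^ 2))) := by rw [div_eq_mul_inv]; ring
        _ = K := by rw [inv_mul_cancel₀ hn, one_mul, succ_mul_hsDiameter_pow_three, hKdef]
    refine (mul_le_mul' le_rfl (hw.trans (mul_le_mul' le_rfl (mmr_lintegral_norm_sub_sq_prod_gaussMeasure_le u hθpos)))).trans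
      (le_of_eq ?_)
    rw [← ENNReal.ofReal_mul h4, ← ENNReal.ofReal_mul hε0, hreal]
  have h := integral_relSpeedFunctional_flow_le_of_relSpeedFluxBound ha hθ hu ha0 hθ0 hσ hσ2 (Φ N) h₁ h₁₂ hK0 hflux
  rwa [← integral_const_mul] at h

end RelSpeedCollisionMeanBound

open RelSpeedCollisionMeanBound in
/-- **The registered stub `stub_relSpeedCollisionMeanBound` FOLLOWS from the crux item
`Theses.BGEndpointRigidity.LanfordEnvelopeR`** (stmt-AtomisticToContinuum-13677, the Lanford/BGSR Gaussian envelope of all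
marginals of the evolved local Gibbs law, open at positive times at fixed reduced density): `LanfordEnvelopeR` ⟹ marginal
envelope (A) (`CollisionRate.stub_marginalEnvelopeLG_of_lanfordEnvelopeR`) ⟹ the stub (`RelSpeedCollisionMeanBound.stub_of_marginalEnvelope`).
[folklore] -/
theorem stub_relSpeedCollisionMeanBound_of_lanfordEnvelopeR : Summit.AtomisticToContinuum.HydrodynamicLimit.Theses.BGEndpointRigidity.LanfordEnvelopeR → ∀ (a₀ θ₀ : Literature.MathematicalPhysics.KineticTheory.T3 → ℝ) (u₀ : Literature.MathematicalPhysics.KineticTheory.T3 → Literature.MathematicalPhysics.KineticTheory.V3), Continuous a₀ → Continuous θ₀ → Continuous u₀ → (∀ x, 0 < a₀ x) → (∀ x, 0 < θ₀ x) → ∃ σ₀ : ℝ, 0 < σ₀ ∧ ∀ σ : ℝ, 0 < σ → σ < σ₀ → ∀ Φ : (N : ℕ) → Literature.Analysis.FluidPDE.HardSphereFlow (Literature.Analysis.FluidPDE.Torus.geometry (Fin 3)) (Literature.MathematicalPhysics.KineticTheory.hsDiameter σ N) (N + 1), ∀ t₁ t₂ : ℝ, 0 ≤ t₁ → t₁ ≤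 t₂ → ∃ C : ℝ, ∀ᶠ N in Filter.atTop, ∀ Q : Literature.Analysis.FluidPDE.Config (N + 1) (Fin 3) Literature.MathematicalPhysics.KineticTheory.T3 → ℝ, Q = (fun z => Literature.MathematicalPhysics.KineticTheory.hsDiameter σ N * ((N + 1 : ℕ) : ℝ)⁻¹ * (Φ N).collisionalTransferFunctional (fun (i j : Fin (N + 1)) (pre _post : Literature.Analysis.FluidPDE.Config (N + 1) (Fin 3) Literature.MathematicalPhysics.KineticTheory.T3) => ‖(pre i).2 - (pre j).2‖) ((Φ N).flow t₁ z) (t₂ - t₁)) → MeasureTheory.Integrable Q (Literature.MathematicalPhysics.KineticTheory.localGibbsLaw σ a₀ u₀ θ₀ N (Φ N)) ∧ ∫ z, Q z ∂Literature.MathematicalPhysics.KineticTheory.localGibbsLaw σ a₀ u₀ θ₀ N (Φ N) ≤ C :=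
  fun hL => stub_of_marginalEnvelope (CollisionRate.stub_marginalEnvelopeLG_of_lanfordEnvelopeR hL)

end Summit.AtomisticToContinuum.HydrodynamicLimit.Theorems

end
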